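import Mathlib.Analysis.SpecialFunctions.Pow.Real
import Mathlib.Analysis.Complex.Basic

/-!
# A-priori box for eigenvalues from the energy identity (SKEWCUT-PAIR §8, Lemma 6.1)

Kernel-checked arithmetic core of the a-priori localisation of eigenvalues of an operator
`L = -ν A + G + F` on a Hilbert space, where `A ≥ 1` is the Stokes-type dissipation,
`G` is skew (its quadratic form is purely imaginary and controlled by `‖A^{1/2} v‖ ‖v‖`) and
`F` is bounded with real part of its quadratic form in `[-s, s]`.  Pairing `L v = λ v` with
`v` gives the ENERGY IDENTITY `λ ‖v‖² = -ν ⟨A v, v⟩ + ⟨G v, v⟩ + ⟨F v, v⟩`; everything below is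
a consequence of that identity for the five NUMBERS

* `n = ‖v‖² > 0`, `a = ⟨A v, v⟩ ≥ n`,
* `g = ⟨G v, v⟩` with `re g = 0` and `‖g‖ ≤ c_G √a √n`,
* `f = ⟨F v, v⟩` with `|re f| ≤ s n`, `|im f| ≤ c_F n`,

namely `re λ ≤ s - ν`, `a / n ≤ (s - re λ)/ν` and `|im λ| ≤ c_G √((s - re λ)/ν) + c_F`
(`apriori_re_le`, `dissipation_ratio_le`, `apriori_im_le`), i.e. every eigenvalue with
`re λ ≥ r` lies in the box `[r, s - ν] × [-Y, Y]`, `Y = c_G √((s - r)/ν) + c_F` (`apriori_box`).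
For the forced ABC flow the cap/instab seats use `s = √2`, `c_G = ‖U‖_∞ = √6`,
`c_F = ½‖curl U‖_∞ = √6/2` (paper-grade instance data, not part of this file).

MODEL/linear bookkeeping (cell ns-blowup, cap seat); nothing here is specific to
Navier–Stokes and no operator theory is used: the analytic input is exactly the energy
identity, taken as the hypothesis `h`.
-/

namespace Summit.NavierStokesRegularity.FluidComputer.EigenvalueAPrioriBox

open Complex

/-- Real part of the energy identity: `re λ · n = -ν a + re f`. -/
theorem re_identity {ν n a : ℝ} {g f lam : ℂ} (hg : g.re = 0)
    (h : lam * (n : ℂ) = -(ν : ℂ) * (a : ℂ) + g + f) : lam.re * n = -ν * a + f.re := by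
  have := congrArg Complex.re h
  simpa [Complex.mul_re, hg] using this

/-- Imaginary part of the energy identity: `im λ · n = im g + im f`. -/
theorem im_identity {ν n a : ℝ} {g f lam : ℂ}
    (h : lam * (n : ℂ) = -(ν : ℂ) * (a : ℂ) + g + f) : lam.im * n = g.im + f.im := by
  have := congrArg Complex.im h
  simpa [Complex.mul_im] using this

/-- Upper bound on the real part: `re λ ≤ s - ν` (uses `a ≥ n > 0`, `ν ≥ 0`,
`re f ≤ s n`). -/
theorem apriori_re_le {ν s n a : ℝ} {g f lam : ℂ} (hν : 0 ≤ ν) (hn : 0 < n) (ha : n ≤ a)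
    (hg : g.re = 0) (hf : f.re ≤ s * n)
    (h : lam * (n : ℂ) = -(ν : ℂ) * (a : ℂ) + g + f) : lam.re ≤ s - ν := by
  have hre := re_identity hg h
  have h1 : lam.re * n ≤ (s - ν) * n := by
    have : -ν * a ≤ -ν * n := by nlinarith
    nlinarith
  exact le_of_mul_le_mul_right h1 hn

/-- Lower bound on the real part: `re λ ≥ -ν a / n - s` (uses `re f ≥ -s n`). -/
theorem apriori_re_ge {ν s n a : ℝ} {g f lam : ℂ} (hn : 0 < n)
    (hg : g.re = 0) (hf : -(s * n) ≤ f.re)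
    (h : lam * (n : ℂ) = -(ν : ℂ) * (a : ℂ) + g + f) : -ν * a / n - s ≤ lam.re := by
  have hre := re_identity hg h
  have h1 : (-ν * a / n - s) * n ≤ lam.re * n := by
    have : (-ν * a / n - s) * n = -ν * a - s * n := by field_simp
    rw [this]; linarith
  exact le_of_mul_le_mul_right h1 hn

/-- The dissipation ratio is controlled by the real part: `a / n ≤ (s - re λ)/ν`
(uses `ν > 0`, `re f ≤ s n`). -/
theorem dissipation_ratio_le {ν s n a : ℝ} {g f lam : ℂ} (hν : 0 < ν) (hn : 0 < n)
    (hg : g.re = 0) (hf : f.re ≤ s * n)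
    (h : lam * (n : ℂ) = -(ν : ℂ) * (a : ℂ) + g + f) : a / n ≤ (s - lam.re) / ν := by
  have hre := re_identity hg h
  rw [div_le_div_iff₀ hn hν]
  nlinarith

/-- Bound on the imaginary part: `|im λ| ≤ c_G √((s - re λ)/ν) + c_F`. -/
theorem apriori_im_le {ν s cG cF n a : ℝ} {g f lam : ℂ} (hν : 0 < ν) (hn : 0 < n)
    (hcG : 0 ≤ cG) (hg : g.re = 0) (hgn : ‖g‖ ≤ cG * Real.sqrt a * Real.sqrt n)
    (hf : f.re ≤ s * n) (hfi : |f.im| ≤ cF * n)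
    (h : lam * (n : ℂ) = -(ν : ℂ) * (a : ℂ) + g + f) :
    |lam.im| ≤ cG * Real.sqrt ((s - lam.re) / ν) + cF := by
  have him := im_identity h
  have hratio := dissipation_ratio_le hν hn hg hf h
  have hsn : 0 < Real.sqrt n := Real.sqrt_pos.2 hn
  have hgim : |g.im| ≤ cG * Real.sqrt a * Real.sqrt n :=
    (Complex.abs_im_le_norm g).trans hgn
  -- |im λ| n ≤ |im g| + |im f| ≤ cG √a √n + cF n
  have h1 : |lam.im| * n ≤ cG * Real.sqrt a * Real.sqrt n + cF * n := by
    have : |lam.im| * n = |lam.im * n| := by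
      rw [abs_mul, abs_of_pos hn]
    rw [this, him]
    exact (abs_add_le _ _).trans (add_le_add hgim hfi)
  -- divide by n = √n √n
  have hnn : Real.sqrt n * Real.sqrt n = n := Real.mul_self_sqrt hn.le
  have e : Real.sqrt a * Real.sqrt n = Real.sqrt a / Real.sqrt n * n := by
    rw [div_mul_eq_mul_div, eq_div_iff hsn.ne', mul_assoc, hnn]
  have h2 : |lam.im| ≤ cG * (Real.sqrt a / Real.sqrt n) + cF := by
    have key : |lam.im| * n ≤ (cG * (Real.sqrt a / Real.sqrt n) + cF) * n := by
      have : (cG * (Real.sqrt a / Real.sqrt n) + cF) * n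
          = cG * Real.sqrt a * Real.sqrt n + cF * n := by
        rw [mul_assoc cG, e]; ring
      rw [this]; exact h1
    exact le_of_mul_le_mul_right key hn
  -- √a/√n = √(a/n) ≤ √((s - re λ)/ν)
  have h3 : Real.sqrt a / Real.sqrt n ≤ Real.sqrt ((s - lam.re) / ν) := by
    rw [← Real.sqrt_div' a hn.le]
    exact Real.sqrt_le_sqrt hratio
  calc |lam.im| ≤ cG * (Real.sqrt a / Real.sqrt n) + cF := h2
    _ ≤ cG * Real.sqrt ((s - lam.re) / ν) + cF := by
        have := mul_le_mul_of_nonneg_left h3 hcG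
        linarith

/-- THE A-PRIORI BOX (SKEWCUT-PAIR §8, Lemma 6.1 / Corollary): under the energy identity,
an eigenvalue with `re λ ≥ r` satisfies `r ≤ re λ ≤ s - ν` and
`|im λ| ≤ c_G √((s - r)/ν) + c_F`. -/
theorem apriori_box {ν s cG cF n a r : ℝ} {g f lam : ℂ} (hν : 0 < ν) (hn : 0 < n)
    (ha : n ≤ a) (hcG : 0 ≤ cG) (hg : g.re = 0)
    (hgn : ‖g‖ ≤ cG * Real.sqrt a * Real.sqrt n) (hf : f.re ≤ s * n) (hfi : |f.im| ≤ cF * n)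
    (h : lam * (n : ℂ) = -(ν : ℂ) * (a : ℂ) + g + f) (hr : r ≤ lam.re) :
    lam.re ≤ s - ν ∧ |lam.im| ≤ cG * Real.sqrt ((s - r) / ν) + cF := by
  refine ⟨apriori_re_le hν.le hn ha hg hf h, (apriori_im_le hν hn hcG hg hgn hf hfi h).trans ?_⟩
  have : Real.sqrt ((s - lam.re) / ν) ≤ Real.sqrt ((s - r) / ν) :=
    Real.sqrt_le_sqrt (div_le_div_of_nonneg_right (by linarith) hν.le)
  have := mul_le_mul_of_nonneg_left this hcG
  linarith

end Summit.NavierStokesRegularity.FluidComputer.EigenvalueAPrioriBox
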